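import Literature.Probability.LatticeModels.DartPhase
import Literature.Probability.LatticeModels.DirichletGreenFunction
import Literature.Probability.RandomPlanarGeometry.PlanarDomains
import Summits.CriticalPhenomena.CardyFormulaZ2.Theorems.CardySusyWardParafermionPrecompactKenyonDefs

/-!
# The percolation inputs of stub `stub_touchProfileLaws` as named statements — definitions only

Line `kenyon-stream-second-relation` of the crux `ParafermionPrecompact` (route `CardySusyWard`,
item stmt-CriticalPhenomena-11293), lead `prover-line-stmt-CriticalPhenomena-11293-0`; vocabulary
of `…KenyonDefs` (`deepSites`, `touchProb`, `defectProfile`, `greenWeight`, `greenWeight₂`,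
`nearEdges`) and of the tree (`poissonKernel`, `outerBoundary`). STUB 5 of the line
(`stub_touchProfileLaws`, size XL) asserts, for EVERY Dobrushin domain `D` and discretisation family
`Λ`, on compacts `K ⊂ D` and for every exponent `pz > 4/3`, eventually in the mesh `δ`:
(i-a) the Green-gradient-weighted defect-profile sum over the edges near the `6δ`-deep sites
`Λ_δ = deepSites D δ` is `≤ C δ^{1/3}`; (i-b) the Poisson (discrete harmonic measure) average
`Σ_{w ∈ ∂Λ_δ} H_{Λ_δ}(x₀,w) · touchProb (Λ δ) (δw) δ` is `≤ C δ^{1/3}`; (ii-a), (ii-b) the same sums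
with DIFFERENCE weights for two deep sites at distance `< η` are `≤ ε δ^{1/3}`.

This file isolates the four clauses as predicates ON THE PAIR `(D, Λ)` — so that a planner can
file them with whatever boundary-regularity guard is appropriate (see the scope warning below) —
and records the exact logical status of the stub relative to them:

* `BoundaryTouchHM D Λ` — (i-b), the HARMONIC-MEASURE-AVERAGED BOUNDARY ONE-ARM LAW at exponent
  `1/3` ("[ArmHM]"): the expected discrete harmonic measure, seen from a deep point, of the
  `δ`-sausage of the set of boundary-layer sites touched by the exploration interface is `O(δ^{1/3})`.
  This is the sharp half-plane one-arm UPPER bound of critical bond percolation on `ℤ²`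
  (exponent `1/3`; on `ℤ²` open for every slope — crux stmt-CriticalPhenomena-5662
  `HalfPlaneOneArmThird`; the diagonal direction is Ikhlef–Ponsaing's exact strip formula, the
  tree's named fact `Literature.Probability.Percolation.IkhlefPonsaingFirstPassage`) paired with
  harmonic measure.
* `GreenDefectHM D Λ pz` — (i-a), its Green-gradient companion (bulk `δ^{pz-1}`, boundary layers
  `δ^{1/3} Σ_D D^{1/3-pz}`, convergent iff `pz > 4/3`).
* `PairBoundaryTouchHM D Λ`, `PairGreenDefectHM D Λ pz` — (ii-b), (ii-a).
* `PoissonHarnackModulus D` — a DETERMINISTIC interior Harnack modulus for the Poisson kernel of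
  `Λ_δ` (Lawler–Limic 2010, Thm. 6.3.8–6.3.9, not yet in the tree in difference form), under which
  (ii-b) follows from (i-b) (`pairBoundaryTouchHM_of_harnack`): the percolation content of (ii-b) is nil
  beyond (i-b).
* `touchProfileLaws_iff_laws` (registered carrier sub-goal of this file): for each `(D, Λ)` the body
  of STUB 5 is EQUIVALENT to the conjunction of the four laws — the decomposition loses nothing, and
  `stub_touchProfileLaws` is literally `∀ D Λ, IsFamily D Λ → (the four laws)`.

SCOPE WARNING (triage; standing disprover's note `Cruxes/ParafermionPrecompact/Negative-notes-stub_touchProfileLaws.md`):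
heuristically `Σ_w H(x₀,w) touchProb ≍ δ^{τ_D(4/3)}` with `τ_D` the `L^q`-spectrum of harmonic measure
of `D`; `τ_D(4/3) = 1/3` for piecewise-`C¹` boundaries (corners of any opening, marks included) but
`τ_D(4/3) < 1/3` strictly for multifractal (self-similar fractal) Jordan boundaries, where
`BoundaryTouchHM D Λ` should FAIL. Hence the predicates are stated per domain; nothing in this file
is asserted.

References: G. F. Lawler, *Intersections of Random Walks* (1991), §1.4 [Lawler1991]; G. F. Lawler,
V. Limic, *Random Walk: A Modern Introduction* (2010), Thm. 6.3.8–6.3.9 [LawlerLimic2010];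
S. Smirnov, W. Werner, Math. Res. Lett. 8 (2001) (half-plane exponents on `𝕋`) [SmirnovWernerMRL2001];
Y. Ikhlef, A. K. Ponsaing, J. Stat. Phys. 149 (2012), Props. 4.7–4.9 [IkhlefPonsaing2012];
H. Duminil-Copin, S. Smirnov, Clay Math. Proc. 15 (2012), §8.3 [DuminilCopinSmirnov2012Lattice].
-/

noncomputable section

namespace Summit.CriticalPhenomena.CardyFormulaZ2.Cruxes.ParafermionPrecompact.KenyonStreamSecondRelation

open scoped BigOperators Topology
open Filter Set MeasureTheory
open _root_.Literature.Probability.LatticeModels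
open _root_.Literature.Probability.RandomPlanarGeometry (DobrushinDomain)
open _root_.Literature.Probability.Percolation (BondConfig bondPercolation half)

/-! ### The four laws, per domain and family -/

/-- **[ArmHM] Harmonic-measure-averaged boundary one-arm law at exponent `1/3`** for the pair
`(D, Λ)` (clause (i-b) of STUB 5): on every compact `K ⊂ D` there is `C` with, eventually in `δ`,
for every `6δ`-deep site `x₀` over `K`,
`Σ_{w ∈ ∂Λ_δ} H_{Λ_δ}(x₀, w) · P_{1/2}(the exploration interface of Λ δ comes within δ of δw) ≤ C δ^{1/3}`,
`Λ_δ = deepSites D δ`, `∂Λ_δ` its outer lattice boundary (the layer at distance `[5δ, 6δ]` from `∂D`),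
`H` the Poisson kernel (discrete harmonic measure). Expected for piecewise-`C¹` Jordan boundaries
from the sharp half-plane one-arm exponent `1/3` of critical percolation; open on `ℤ²`; heuristically
false for multifractal boundaries. A statement, not asserted. [folklore] -/
def BoundaryTouchHM (D : DobrushinDomain) (Λ : ℝ → DiscreteDobrushin) : Prop :=
  ∀ K : Set ℂ, IsCompact K → K ⊆ D.carrier →
    ∃ C : ℝ, ∀ᶠ δ in 𝓝[>] (0:ℝ), ∀ x₀ ∈ deepSites D δ, meshPoint δ x₀ ∈ K →
      (∑ w ∈ outerBoundary (zdGraph 2) (deepSites D δ),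
          Literature.Probability.LatticeModels.poissonKernel (deepSites D δ) x₀ w *
            touchProb (Λ δ) (meshPoint δ w) δ) ≤ C * δ ^ ((1:ℝ) / 3)

/-- **Green-gradient-averaged defect-profile law** with exponent `pz` for `(D, Λ)` (clause (i-a) of
STUB 5): on every compact `K ⊂ D` there is `C` with, eventually in `δ`, for every class `q` and every
deep site `x₀` over `K`,
`Σ_{p ∈ nearEdges Λ_δ} greenWeight Λ_δ x₀ q p · defectProfile (Λ δ) pz p ≤ C δ^{1/3}`
(`defectProfile = (δ/depth)^{pz} ×` touch probability of the `depth/2`-ball at the edge midpoint;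
heuristic budget: bulk `δ^{pz-1}`, layer at lattice depth `D` `≈ D^{-pz} ×` the `[ArmHM]` sum at
scale `Dδ` `≈ δ^{1/3} D^{1/3-pz}`, summable iff `pz > 4/3`). A statement, not asserted. [folklore] -/
def GreenDefectHM (D : DobrushinDomain) (Λ : ℝ → DiscreteDobrushin) (pz : ℝ) : Prop :=
  ∀ K : Set ℂ, IsCompact K → K ⊆ D.carrier →
    ∃ C : ℝ, ∀ᶠ δ in 𝓝[>] (0:ℝ), ∀ (q : Fin 4), ∀ x₀ ∈ deepSites D δ, meshPoint δ x₀ ∈ K →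
      (∑ p ∈ nearEdges (deepSites D δ),
          greenWeight (deepSites D δ) x₀ q p * defectProfile (Λ δ) pz p) ≤ C * δ ^ ((1:ℝ) / 3)

/-- **Pair form of [ArmHM]** for `(D, Λ)` (clause (ii-b) of STUB 5): the Poisson-DIFFERENCE average
`Σ_w |H(x₀,w) - H(x₁,w)| · touchProb` is `≤ ε δ^{1/3}` for deep sites `x₀, x₁` over `K` at distance
`< η(ε)`. Follows from `BoundaryTouchHM D Λ` and the deterministic `PoissonHarnackModulus D`
(`pairBoundaryTouchHM_of_harnack`). A statement, not asserted. [folklore] -/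
def PairBoundaryTouchHM (D : DobrushinDomain) (Λ : ℝ → DiscreteDobrushin) : Prop :=
  ∀ K : Set ℂ, IsCompact K → K ⊆ D.carrier → ∀ ε > (0:ℝ), ∃ η > (0:ℝ), ∀ᶠ δ in 𝓝[>] (0:ℝ),
    ∀ x₀ ∈ deepSites D δ, ∀ x₁ ∈ deepSites D δ, meshPoint δ x₀ ∈ K → meshPoint δ x₁ ∈ K →
      dist (meshPoint δ x₀) (meshPoint δ x₁) < η →
        (∑ w ∈ outerBoundary (zdGraph 2) (deepSites D δ),
            |Literature.Probability.LatticeModels.poissonKernel (deepSites D δ) x₀ w -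
                Literature.Probability.LatticeModels.poissonKernel (deepSites D δ) x₁ w| *
              touchProb (Λ δ) (meshPoint δ w) δ) ≤ ε * δ ^ ((1:ℝ) / 3)

/-- **Pair form of the Green-gradient defect law** with exponent `pz` for `(D, Λ)` (clause (ii-a) of
STUB 5): the `greenWeight₂`-weighted defect-profile sum is `≤ ε δ^{1/3}` for deep sites `x₀, x₁` over
`K` at distance `< η(ε)`, for every class `q`. A statement, not asserted. [folklore] -/
def PairGreenDefectHM (D : DobrushinDomain) (Λ : ℝ → DiscreteDobrushin) (pz : ℝ) : Prop :=
  ∀ K : Set ℂ, IsCompact K → K ⊆ D.carrier → ∀ ε > (0:ℝ), ∃ η > (0:ℝ), ∀ᶠ δ in 𝓝[>] (0:ℝ),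
    ∀ (q : Fin 4), ∀ x₀ ∈ deepSites D δ, ∀ x₁ ∈ deepSites D δ,
      meshPoint δ x₀ ∈ K → meshPoint δ x₁ ∈ K → dist (meshPoint δ x₀) (meshPoint δ x₁) < η →
        (∑ p ∈ nearEdges (deepSites D δ),
            greenWeight₂ (deepSites D δ) x₀ x₁ q p * defectProfile (Λ δ) pz p) ≤ ε * δ ^ ((1:ℝ) / 3)

/-- **Interior Harnack modulus of the Poisson kernel of the deep sites** of `D` (deterministic
discrete potential theory): for deep sites `x₀, x₁` over a compact `K ⊂ D` at distance `< η(ε)`,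
eventually in `δ`, `|H_{Λ_δ}(x₀,w) - H_{Λ_δ}(x₁,w)| ≤ ε H_{Λ_δ}(x₀,w)` for every `w ∈ ∂Λ_δ`.
True for every Jordan domain: `H(·,w) ≥ 0` is lattice harmonic on the lattice ball of radius
`≍ dist(K,∂D)/δ` about `x₀` (which misses the neighbours of `w`), and the difference estimate for
nonnegative harmonic functions in a ball (Lawler–Limic 2010, Thm. 6.3.8 with the Harnack inequality
Thm. 6.3.9) gives `|u(x₁) - u(x₀)| ≤ c (|x₁-x₀|/R) u(x₀)`. Not yet in the tree in this form (the tree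
has the one-scale lower Harnack bound `harnack_one_scale`). A statement, not asserted. [folklore] -/
def PoissonHarnackModulus (D : DobrushinDomain) : Prop :=
  ∀ K : Set ℂ, IsCompact K → K ⊆ D.carrier → ∀ ε > (0:ℝ), ∃ η > (0:ℝ), ∀ᶠ δ in 𝓝[>] (0:ℝ),
    ∀ x₀ ∈ deepSites D δ, ∀ x₁ ∈ deepSites D δ, meshPoint δ x₀ ∈ K → meshPoint δ x₁ ∈ K →
      dist (meshPoint δ x₀) (meshPoint δ x₁) < η →
        ∀ w ∈ outerBoundary (zdGraph 2) (deepSites D δ),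
          |Literature.Probability.LatticeModels.poissonKernel (deepSites D δ) x₀ w -
              Literature.Probability.LatticeModels.poissonKernel (deepSites D δ) x₁ w| ≤
            ε * Literature.Probability.LatticeModels.poissonKernel (deepSites D δ) x₀ w

/-! ### (ii-b) from (i-b) and the Harnack modulus -/

/-- **(ii-b) ⇐ (i-b) + Harnack.** The pair form of the averaged touch law follows from the averaged
touch law and the interior Harnack modulus of the Poisson kernel:
`Σ_w |H(x₀,w) - H(x₁,w)| t(w) ≤ ε' Σ_w H(x₀,w) t(w) ≤ ε' C δ^{1/3}` with `ε' = ε / max C 1`. [folklore] -/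
theorem pairBoundaryTouchHM_of_harnack (D : DobrushinDomain) (Λ : ℝ → DiscreteDobrushin)
    (hH : PoissonHarnackModulus D) (hT : BoundaryTouchHM D Λ) : PairBoundaryTouchHM D Λ := by
  intro K hK hKD ε hε
  obtain ⟨C, hC⟩ := hT K hK hKD
  set C₁ : ℝ := max C 1 with hC₁def
  have hC₁ : 0 < C₁ := lt_of_lt_of_le zero_lt_one (le_max_right _ _)
  obtain ⟨η, hη, hev⟩ := hH K hK hKD (ε / C₁) (div_pos hε hC₁)
  refine ⟨η, hη, ?_⟩
  have hpos : ∀ᶠ δ in 𝓝[>] (0:ℝ), 0 < δ := eventually_mem_nhdsWithin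
  filter_upwards [hC, hev, hpos] with δ hCδ hevδ hδ
  intro x₀ hx₀ x₁ hx₁ hx₀K hx₁K hd
  have hrpow : 0 ≤ δ ^ ((1:ℝ) / 3) := Real.rpow_nonneg hδ.le _
  have ht0 : ∀ w, 0 ≤ touchProb (Λ δ) (meshPoint δ w) δ := fun w => measureReal_nonneg
  calc (∑ w ∈ outerBoundary (zdGraph 2) (deepSites D δ),
        |poissonKernel (deepSites D δ) x₀ w - poissonKernel (deepSites D δ) x₁ w| *
          touchProb (Λ δ) (meshPoint δ w) δ)
      ≤ ∑ w ∈ outerBoundary (zdGraph 2) (deepSites D δ),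
          ε / C₁ * poissonKernel (deepSites D δ) x₀ w * touchProb (Λ δ) (meshPoint δ w) δ :=
        Finset.sum_le_sum fun w hw =>
          mul_le_mul_of_nonneg_right (hevδ x₀ hx₀ x₁ hx₁ hx₀K hx₁K hd w hw) (ht0 w)
    _ = ε / C₁ * ∑ w ∈ outerBoundary (zdGraph 2) (deepSites D δ),
          poissonKernel (deepSites D δ) x₀ w * touchProb (Λ δ) (meshPoint δ w) δ := by
        rw [Finset.mul_sum]
        refine Finset.sum_congr rfl fun w _ => by ring
    _ ≤ ε / C₁ * (C * δ ^ ((1:ℝ) / 3)) :=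
        mul_le_mul_of_nonneg_left (hCδ x₀ hx₀ hx₀K) (div_pos hε hC₁).le
    _ ≤ ε / C₁ * (C₁ * δ ^ ((1:ℝ) / 3)) :=
        mul_le_mul_of_nonneg_left (mul_le_mul_of_nonneg_right (le_max_left _ _) hrpow)
          (div_pos hε hC₁).le
    _ = ε * δ ^ ((1:ℝ) / 3) := by field_simp

/-! ### The stub is exactly the conjunction of the four laws -/

/-- **Registered carrier sub-goal.** For each Dobrushin domain `D` and family `Λ`, the body of
STUB 5 `stub_touchProfileLaws` (both clauses, all compacts `K ⊂ D`, all exponents `pz > 4/3`) is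
EQUIVALENT to: `BoundaryTouchHM D Λ`, `PairBoundaryTouchHM D Λ`, and `GreenDefectHM D Λ pz`,
`PairGreenDefectHM D Λ pz` for every `pz > 4/3`. (`→`: specialise to `pz = 2`, `q = 0`; `←`: take the
maximum of the two constants, the minimum of the two `η`, and intersect the eventualities.) [folklore] -/
theorem touchProfileLaws_iff_laws : ∀ (D : DobrushinDomain) (Λ : ℝ → DiscreteDobrushin),
    (∀ K : Set ℂ, IsCompact K → K ⊆ D.carrier → ∀ pz : ℝ, 4 / 3 < pz →
      (∃ C : ℝ, ∀ᶠ δ in 𝓝[>] (0:ℝ), ∀ (q : Fin 4), ∀ x₀ ∈ deepSites D δ, meshPoint δ x₀ ∈ K →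
          (∑ p ∈ nearEdges (deepSites D δ),
              greenWeight (deepSites D δ) x₀ q p * defectProfile (Λ δ) pz p) ≤ C * δ ^ ((1:ℝ) / 3) ∧
            (∑ w ∈ outerBoundary (zdGraph 2) (deepSites D δ),
              Literature.Probability.LatticeModels.poissonKernel (deepSites D δ) x₀ w *
                touchProb (Λ δ) (meshPoint δ w) δ) ≤ C * δ ^ ((1:ℝ) / 3)) ∧
        ∀ ε > (0:ℝ), ∃ η > (0:ℝ), ∀ᶠ δ in 𝓝[>] (0:ℝ), ∀ (q : Fin 4),
          ∀ x₀ ∈ deepSites D δ, ∀ x₁ ∈ deepSites D δ, meshPoint δ x₀ ∈ K → meshPoint δ x₁ ∈ K →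
            dist (meshPoint δ x₀) (meshPoint δ x₁) < η →
              (∑ p ∈ nearEdges (deepSites D δ),
                  greenWeight₂ (deepSites D δ) x₀ x₁ q p * defectProfile (Λ δ) pz p) ≤
                  ε * δ ^ ((1:ℝ) / 3) ∧
                (∑ w ∈ outerBoundary (zdGraph 2) (deepSites D δ),
                  |Literature.Probability.LatticeModels.poissonKernel (deepSites D δ) x₀ w -
                      Literature.Probability.LatticeModels.poissonKernel (deepSites D δ) x₁ w| *
                    touchProb (Λ δ) (meshPoint δ w) δ) ≤ ε * δ ^ ((1:ℝ) / 3)) ↔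
      (BoundaryTouchHM D Λ ∧ PairBoundaryTouchHM D Λ ∧
        (∀ pz : ℝ, 4 / 3 < pz → GreenDefectHM D Λ pz) ∧
          ∀ pz : ℝ, 4 / 3 < pz → PairGreenDefectHM D Λ pz) := by
  intro D Λ
  have h2 : (4:ℝ) / 3 < 2 := by norm_num
  constructor
  · intro h
    refine ⟨fun K hK hKD => ?_, fun K hK hKD ε hε => ?_, fun pz hpz K hK hKD => ?_,
      fun pz hpz K hK hKD ε hε => ?_⟩
    · obtain ⟨C, hC⟩ := (h K hK hKD 2 h2).1
      exact ⟨C, hC.mono fun δ hδ x₀ hx₀ hx₀K => (hδ 0 x₀ hx₀ hx₀K).2⟩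
    · obtain ⟨η, hη, hev⟩ := (h K hK hKD 2 h2).2 ε hε
      exact ⟨η, hη, hev.mono fun δ hδ x₀ hx₀ x₁ hx₁ hx₀K hx₁K hd =>
        (hδ 0 x₀ hx₀ x₁ hx₁ hx₀K hx₁K hd).2⟩
    · obtain ⟨C, hC⟩ := (h K hK hKD pz hpz).1
      exact ⟨C, hC.mono fun δ hδ q x₀ hx₀ hx₀K => (hδ q x₀ hx₀ hx₀K).1⟩
    · obtain ⟨η, hη, hev⟩ := (h K hK hKD pz hpz).2 ε hε
      exact ⟨η, hη, hev.mono fun δ hδ q x₀ hx₀ x₁ hx₁ hx₀K hx₁K hd =>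
        (hδ q x₀ hx₀ x₁ hx₁ hx₀K hx₁K hd).1⟩
  · rintro ⟨hb, hpb, hg, hpg⟩ K hK hKD pz hpz
    have hpos : ∀ᶠ δ in 𝓝[>] (0:ℝ), 0 < δ := eventually_mem_nhdsWithin
    constructor
    · obtain ⟨C₁, hC₁⟩ := hb K hK hKD
      obtain ⟨C₂, hC₂⟩ := hg pz hpz K hK hKD
      refine ⟨max C₁ C₂, ?_⟩
      filter_upwards [hC₁, hC₂, hpos] with δ h₁ h₂' hδ
      intro q x₀ hx₀ hx₀K
      have hrpow : 0 ≤ δ ^ ((1:ℝ) / 3) := Real.rpow_nonneg hδ.le _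
      exact ⟨(h₂' q x₀ hx₀ hx₀K).trans (mul_le_mul_of_nonneg_right (le_max_right _ _) hrpow),
        (h₁ x₀ hx₀ hx₀K).trans (mul_le_mul_of_nonneg_right (le_max_left _ _) hrpow)⟩
    · intro ε hε
      obtain ⟨η₁, hη₁, hev₁⟩ := hpb K hK hKD ε hε
      obtain ⟨η₂, hη₂, hev₂⟩ := hpg pz hpz K hK hKD ε hε
      refine ⟨min η₁ η₂, lt_min hη₁ hη₂, ?_⟩
      filter_upwards [hev₁, hev₂] with δ h₁ h₂'
      intro q x₀ hx₀ x₁ hx₁ hx₀K hx₁K hd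
      exact ⟨h₂' q x₀ hx₀ x₁ hx₁ hx₀K hx₁K (hd.trans_le (min_le_right _ _)),
        h₁ x₀ hx₀ x₁ hx₁ hx₀K hx₁K (hd.trans_le (min_le_left _ _))⟩

end Summit.CriticalPhenomena.CardyFormulaZ2.Cruxes.ParafermionPrecompact.KenyonStreamSecondRelation

end
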